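import Mathlib
import Summits.Ventures.PercRepro.TriangleCapTriangleFreeThreeB

/-!
# PercRepro — THREE BELOW THE DIAGONAL ON TRIANGLE-FREE GRAPHS, PART C: the case `|Z| = 2`, the assembly, and
the theorems (p3, gen 36; part 42)

* **`core_Z2`** — `|Z| = 2`: a missing `X`–`Y` pair pays `|X| + |Y| − 2` (§10at's count) on top of the two `z`'s
  `2 (|X| + |Y| − 1)`; with every `X`–`Y` pair adjacent the graph is bipartite unless `z₁ ~ z₂` with neighbours on
  the same side (`bipartite_of_Z_pair`), where the far-pair products `|X ∖ N(z_i)|·|Y|`, the edges at the `z_i` and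
  the edge `z₁ z₂` (all of `Y` in its deficit, both orientations) pay `6 (k − 4)` (`arith_Z2`);
* **`six_mul_le_sum_deficit_of_not_bipartite`** — triangle-free, not bipartite spanning, an edge `u v` with
  `d(u) ≥ 4` ⇒ `Σ deficit ≥ 6 (k − 4)` (`|Z| ≥ 3` by the quadratic `|Z| (k − |Z| − 1) ≥ 3 (k − 4)`, as `|Z| ≤ k − 5`);
* **`triangle_free_stability_three`** — a triangle-free graph on `k` vertices with `m ≥ 2k − 3` edges that is not
  bipartite spanning with `≤ 2` missing cross pairs has `Σ_v d(v)² + 3 (k − 4) ≤ m·k` (a vertex of degree `≥ 4`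
  exists for `k ≥ 7`; `k ≤ 6` is the `r = 2` core);
* **`three_below_diagonal_cliqueFree_exact`** — for `1 ≤ a`, `a + 3 ≤ k`, `m = a(k − a) − 3 ≥ 2k − 3` with `m`, `m + 1`,
  `m + 2` not of the form `a′(k − a′)`: the maximum of `2·Σ_v C(d(v), 2)` over the TRIANGLE-FREE graphs on `Fin k` with
  `m` edges IS `m (k − 2) − 3 (k − 4)`, by `K_{a, k−a}` minus three edges at one vertex — the sub-diagonal `r = 3` of the
  closed form P3-TRIANGLE-CAP.md §10av on the triangle-free class: `(9,15) 45 · (10,18) 63 · (11,21) 84 · (12,24) 108`.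
Axioms: standard.
-/

namespace PercRepro

namespace TriangleCap

namespace C047

open Finset

variable {V : Type*} [Fintype V] [DecidableEq V]

/-- **THE CASE `|Z| = 2`** of the `r = 3` core. -/
theorem core_Z2 (D : SimpleGraph V) [DecidableRel D.Adj]
    (htri : ∀ a b c, D.Adj a b → D.Adj a c → D.Adj b c → False) {u v : V} (huv : D.Adj u v)
    (X Y Z : Finset V) (memX : ∀ w, w ∈ X ↔ D.Adj v w) (memY : ∀ w, w ∈ Y ↔ D.Adj u w)
    (memZ : ∀ w, w ∈ Z ↔ ¬ D.Adj v w ∧ ¬ D.Adj u w)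
    (A₁ A₃ A₅ : Finset (V × V)) (memA₁ : ∀ p, p ∈ A₁ ↔ D.Adj p.1 p.2 ∧ D.Adj v p.1 ∧ D.Adj u p.2)
    (memA₃ : ∀ p, p ∈ A₃ ↔ D.Adj p.1 p.2 ∧ (¬ D.Adj v p.1 ∧ ¬ D.Adj u p.1) ∧ (D.Adj v p.2 ∨ D.Adj u p.2))
    (memA₅ : ∀ p, p ∈ A₅ ↔ D.Adj p.1 p.2 ∧ (¬ D.Adj v p.1 ∧ ¬ D.Adj u p.1) ∧ (¬ D.Adj v p.2 ∧ ¬ D.Adj u p.2))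
    (hA1sum : ∑ p ∈ A₁, (X.filter (fun w => ¬ D.Adj p.2 w)).card +
      ∑ p ∈ A₁, (Y.filter (fun w => ¬ D.Adj p.1 w)).card +
        ∑ p ∈ A₁, (Z.filter (fun w => ¬ D.Adj p.1 w ∧ ¬ D.Adj p.2 w)).card ≤ ∑ p ∈ A₁, deficit D p)
    (hnb : ¬ ∃ A : Finset V, ∀ x y, D.Adj x y → (x ∈ A ↔ y ∉ A))
    (hY4 : 4 ≤ Y.card) (hZ2 : Z.card = 2) :
    6 * (X.card + Y.card + Z.card - 4) ≤ 2 * ∑ p ∈ A₁, deficit D p + 2 * ∑ p ∈ A₃, deficit D p +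
      ∑ p ∈ A₅, deficit D p := by
  have huX : u ∈ X := (memX u).mpr huv.symm
  have hvY : v ∈ Y := (memY v).mpr huv
  have hX1 : 1 ≤ X.card := card_pos.mpr ⟨u, huX⟩
  have hfarZ : ∑ p ∈ A₁, (Z.filter (fun w => ¬ D.Adj p.1 w ∧ ¬ D.Adj p.2 w)).card =
      ∑ z ∈ Z, (A₁.filter (fun p => ¬ D.Adj p.1 z ∧ ¬ D.Adj p.2 z)).card := by
    simp only [card_filter]
    rw [sum_comm]
  have hA3sum := edges_at_Z_lower D htri huv X Y Z memX memY memZ A₃ memA₃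
  rw [hZ2]
  have e : X.card + Y.card + 2 - 4 = X.card + Y.card - 2 := by omega
  rw [e]
  by_cases hN : 1 ≤ (missing D X Y).card
  · -- a missing pair: §10at's count plus the two `z`'s
    obtain ⟨⟨x₀, y₀⟩, hm⟩ := card_pos.mp hN
    unfold missing at hm
    rw [mem_filter, mem_product] at hm
    have hp := xy_pair_lower D huv X Y memX memY A₁ memA₁ hm.1.1 hm.1.2 hm.2
    have hZtotal : Z.card * (X.card + Y.card) ≤
        ∑ p ∈ A₁, (Z.filter (fun w => ¬ D.Adj p.1 w ∧ ¬ D.Adj p.2 w)).card + ∑ p ∈ A₃, deficit D p + Z.card := by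
      have hper : ∀ z ∈ Z, X.card + Y.card ≤
          ((X.filter (fun w => D.Adj z w)).card * (X.filter (fun x => ¬ D.Adj z x)).card +
            (Y.filter (fun w => D.Adj z w)).card * (Y.filter (fun y => ¬ D.Adj z y)).card) +
          ((X.filter (fun x => ¬ D.Adj z x)).card + (Y.filter (fun y => ¬ D.Adj z y)).card) := by
        intro z hz
        have hz' := (memZ z).mp hz
        exact per_z_arith D X Y huX hvY hz'.1 hz'.2
      have h := sum_le_sum hper
      rw [sum_const, smul_eq_mul, sum_add_distrib] at h
      have hfarsum : ∑ z ∈ Z, ((X.filter (fun x => ¬ D.Adj z x)).card + (Y.filter (fun y => ¬ D.Adj z y)).card) ≤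
          ∑ p ∈ A₁, (Z.filter (fun w => ¬ D.Adj p.1 w ∧ ¬ D.Adj p.2 w)).card + Z.card := by
        rw [hfarZ, card_eq_sum_ones, ← sum_add_distrib]
        apply sum_le_sum
        intro z hz
        have hz' := (memZ z).mp hz
        exact far_pairs_lower D huv X Y memX memY A₁ memA₁ hz'.1 hz'.2
      omega
    rw [hZ2] at hZtotal
    omega
  · -- every `X`–`Y` pair adjacent
    have hN0 : (missing D X Y).card = 0 := by omega
    have hall : ∀ x ∈ X, ∀ y ∈ Y, D.Adj x y := by
      intro x hx y hy
      by_contra h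
      have : (x, y) ∈ missing D X Y := by
        unfold missing
        rw [mem_filter, mem_product]
        exact ⟨⟨hx, hy⟩, h⟩
      rw [card_eq_zero] at hN0
      rw [hN0] at this
      exact notMem_empty _ this
    obtain ⟨z₁, z₂, hne, hZeq⟩ := card_eq_two.mp hZ2
    have hz₁Z : z₁ ∈ Z := by rw [hZeq]; exact mem_insert_self _ _
    have hz₂Z : z₂ ∈ Z := by rw [hZeq]; exact mem_insert_of_mem (mem_singleton_self _)
    have hz₁ := (memZ z₁).mp hz₁Z
    have hz₂ := (memZ z₂).mp hz₂Z
    have hclass : ∀ w, D.Adj v w ∨ D.Adj u w ∨ w = z₁ ∨ w = z₂ := by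
      intro w
      by_cases h1 : D.Adj v w
      · exact Or.inl h1
      by_cases h2 : D.Adj u w
      · exact Or.inr (Or.inl h2)
      have hw : w ∈ Z := (memZ w).mpr ⟨h1, h2⟩
      rw [hZeq, mem_insert, mem_singleton] at hw
      exact Or.inr (Or.inr hw)
    rcases bipartite_of_Z_pair D htri huv X Y memX memY hne hz₁ hz₂ hclass hall with hb | ⟨h12, hside⟩
    · exact (hnb hb).elim
    have hone : ∀ z, (∃ x ∈ X, D.Adj z x) → (∃ y ∈ Y, D.Adj z y) → False := by
      rintro z ⟨x, hx, hzx⟩ ⟨y, hy, hzy⟩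
      exact htri z x y hzx hzy (hall x hx y hy)
    -- the sums over `Z = {z₁, z₂}`
    rw [hfarZ, hZeq, sum_pair hne] at hA1sum
    rw [hZeq, sum_pair hne] at hA3sum
    -- the edge `z₁ z₂` inside `A₅`, both orientations
    have hA5pair : deficit D (z₁, z₂) + deficit D (z₂, z₁) ≤ ∑ p ∈ A₅, deficit D p := by
      have hsub : ({(z₁, z₂), (z₂, z₁)} : Finset (V × V)) ⊆ A₅ := by
        intro p hp
        rw [mem_insert, mem_singleton] at hp
        rw [memA₅]
        rcases hp with rfl | rfl
        · exact ⟨h12, hz₁, hz₂⟩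
        · exact ⟨h12.symm, hz₂, hz₁⟩
      have hne' : ((z₁, z₂) : V × V) ≠ (z₂, z₁) := fun h => hne (Prod.mk.inj h).1
      have := sum_le_sum_of_subset_of_nonneg hsub (fun _ _ _ => Nat.zero_le _) (f := deficit D)
      rw [sum_pair hne'] at this
      exact this
    have hprod₁ := far_pairs_product_lower D X Y memX memY A₁ memA₁ z₁
    have hprod₂ := far_pairs_product_lower D X Y memX memY A₁ memA₁ z₂
    rw [hN0] at hprod₁ hprod₂
    have hXc₁ := card_filter_add_card_filter_not (s := X) (fun w => D.Adj z₁ w)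
    have hXc₂ := card_filter_add_card_filter_not (s := X) (fun w => D.Adj z₂ w)
    have hYc₁ := card_filter_add_card_filter_not (s := Y) (fun w => D.Adj z₁ w)
    have hYc₂ := card_filter_add_card_filter_not (s := Y) (fun w => D.Adj z₂ w)
    rcases hside with ⟨hx₁, hx₂⟩ | ⟨hy₁, hy₂⟩
    · -- both on the `X` side
      have hnoY₁ : ∀ y ∈ Y, ¬ D.Adj z₁ y := fun y hy h => hone z₁ hx₁ ⟨y, hy, h⟩
      have hnoY₂ : ∀ y ∈ Y, ¬ D.Adj z₂ y := fun y hy h => hone z₂ hx₂ ⟨y, hy, h⟩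
      have hs₁ : (Y.filter (fun w => D.Adj z₁ w)).card = 0 := by
        rw [card_eq_zero, filter_eq_empty_iff]; exact hnoY₁
      have hs₂ : (Y.filter (fun w => D.Adj z₂ w)).card = 0 := by
        rw [card_eq_zero, filter_eq_empty_iff]; exact hnoY₂
      have hb₁ : (Y.filter (fun y => ¬ D.Adj z₁ y)).card = Y.card := by omega
      have hb₂ : (Y.filter (fun y => ¬ D.Adj z₂ y)).card = Y.card := by omega
      have ht₁ : 1 ≤ (X.filter (fun w => D.Adj z₁ w)).card := by
        obtain ⟨x, hx, h⟩ := hx₁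
        exact card_pos.mpr ⟨x, mem_filter.mpr ⟨hx, h⟩⟩
      have ht₂ : 1 ≤ (X.filter (fun w => D.Adj z₂ w)).card := by
        obtain ⟨x, hx, h⟩ := hx₂
        exact card_pos.mpr ⟨x, mem_filter.mpr ⟨hx, h⟩⟩
      have hdisj : (X.filter (fun w => D.Adj z₁ w)).card + (X.filter (fun w => D.Adj z₂ w)).card ≤ X.card := by
        rw [← card_union_of_disjoint]
        · exact card_le_card (union_subset (filter_subset _ _) (filter_subset _ _))
        · rw [disjoint_left]
          intro x h1 h2
          rw [mem_filter] at h1 h2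
          exact htri z₁ z₂ x h12 h1.2 h2.2
      have hd₁ := card_le_deficit_of_no_nbr D Y hnoY₁ hnoY₂
      have hd₂ := card_le_deficit_of_no_nbr D Y hnoY₂ hnoY₁
      rw [hs₁, hs₂, hb₁, hb₂] at hA3sum
      rw [hb₁] at hprod₁
      rw [hb₂] at hprod₂
      have harith := arith_Z2 X.card (X.filter (fun w => D.Adj z₁ w)).card (X.filter (fun w => D.Adj z₂ w)).card
        (X.filter (fun x => ¬ D.Adj z₁ x)).card (X.filter (fun x => ¬ D.Adj z₂ x)).card Y.card hXc₁ hXc₂ ht₁ ht₂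
        hdisj hY4
      omega
    · -- both on the `Y` side
      have hnoX₁ : ∀ x ∈ X, ¬ D.Adj z₁ x := fun x hx h => hone z₁ ⟨x, hx, h⟩ hy₁
      have hnoX₂ : ∀ x ∈ X, ¬ D.Adj z₂ x := fun x hx h => hone z₂ ⟨x, hx, h⟩ hy₂
      have ht₁ : (X.filter (fun w => D.Adj z₁ w)).card = 0 := by
        rw [card_eq_zero, filter_eq_empty_iff]; exact hnoX₁
      have ht₂ : (X.filter (fun w => D.Adj z₂ w)).card = 0 := by
        rw [card_eq_zero, filter_eq_empty_iff]; exact hnoX₂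
      have ha₁ : (X.filter (fun x => ¬ D.Adj z₁ x)).card = X.card := by omega
      have ha₂ : (X.filter (fun x => ¬ D.Adj z₂ x)).card = X.card := by omega
      have hs₁ : 1 ≤ (Y.filter (fun w => D.Adj z₁ w)).card := by
        obtain ⟨y, hy, h⟩ := hy₁
        exact card_pos.mpr ⟨y, mem_filter.mpr ⟨hy, h⟩⟩
      have hs₂ : 1 ≤ (Y.filter (fun w => D.Adj z₂ w)).card := by
        obtain ⟨y, hy, h⟩ := hy₂
        exact card_pos.mpr ⟨y, mem_filter.mpr ⟨hy, h⟩⟩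
      have hdisj : (Y.filter (fun w => D.Adj z₁ w)).card + (Y.filter (fun w => D.Adj z₂ w)).card ≤ Y.card := by
        rw [← card_union_of_disjoint]
        · exact card_le_card (union_subset (filter_subset _ _) (filter_subset _ _))
        · rw [disjoint_left]
          intro y h1 h2
          rw [mem_filter] at h1 h2
          exact htri z₁ z₂ y h12 h1.2 h2.2
      have hd₁ := card_le_deficit_of_no_nbr D X hnoX₁ hnoX₂
      have hd₂ := card_le_deficit_of_no_nbr D X hnoX₂ hnoX₁
      rw [ht₁, ht₂, ha₁, ha₂] at hA3sum
      rw [ha₁] at hprod₁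
      rw [ha₂] at hprod₂
      -- `arith_Z2` with the roles of the sides exchanged: `p = |Y| ≥ 4`, the other side `|X| ≥ 1`
      have key : 6 * (Y.card + X.card - 2) ≤
          2 * ((Y.filter (fun y => ¬ D.Adj z₁ y)).card * X.card + (Y.filter (fun y => ¬ D.Adj z₂ y)).card * X.card) +
          2 * ((Y.filter (fun w => D.Adj z₁ w)).card * (Y.filter (fun y => ¬ D.Adj z₁ y)).card +
            (Y.filter (fun w => D.Adj z₂ w)).card * (Y.filter (fun y => ¬ D.Adj z₂ y)).card) + 2 * X.card := by
        -- the symmetric arithmetic: `Σ_i (q − s_i)(s_i + p) + p ≥ 3 (p + q) − 6` for `q ≥ 4`, `p ≥ 1`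
        exact arith_Z2_swap Y.card (Y.filter (fun w => D.Adj z₁ w)).card (Y.filter (fun w => D.Adj z₂ w)).card
          (Y.filter (fun y => ¬ D.Adj z₁ y)).card (Y.filter (fun y => ¬ D.Adj z₂ y)).card X.card hYc₁ hYc₂ hs₁ hs₂
          hdisj hY4 hX1
      have e2 : Y.card + X.card - 2 = X.card + Y.card - 2 := by omega
      rw [e2] at key
      have hm₁ : (Y.filter (fun y => ¬ D.Adj z₁ y)).card * X.card = X.card * (Y.filter (fun y => ¬ D.Adj z₁ y)).card :=
        Nat.mul_comm _ _
      have hm₂ : (Y.filter (fun y => ¬ D.Adj z₂ y)).card * X.card = X.card * (Y.filter (fun y => ¬ D.Adj z₂ y)).card :=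
        Nat.mul_comm _ _
      omega

/-- **THE NON-BIPARTITE CORE AT `r = 3`:** a triangle-free graph that is not bipartite spanning, with an edge `u v`
and `d(u) ≥ 4`, has ordered deficit sum `≥ 6 (k − 4)`. -/
theorem six_mul_le_sum_deficit_of_not_bipartite (D : SimpleGraph V) [DecidableRel D.Adj]
    (hfree : D.CliqueFree 3) {u v : V} (huv : D.Adj u v) (hu4 : 4 ≤ deg D u)
    (hnb : ¬ ∃ A : Finset V, ∀ x y, D.Adj x y → (x ∈ A ↔ y ∉ A)) :
    6 * (Fintype.card V - 4) ≤ ∑ p ∈ adjPairsAll D, deficit D p := by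
  have htri : ∀ a b c, D.Adj a b → D.Adj a c → D.Adj b c → False := fun a b c hab hac hbc =>
    hfree {a, b, c} (SimpleGraph.is3Clique_triple_iff.mpr ⟨hab, hac, hbc⟩)
  obtain ⟨X, hX⟩ : ∃ X : Finset V, X = univ.filter (fun w => D.Adj v w) := ⟨_, rfl⟩
  obtain ⟨Y, hY⟩ : ∃ Y : Finset V, Y = univ.filter (fun w => D.Adj u w) := ⟨_, rfl⟩
  obtain ⟨Z, hZ⟩ : ∃ Z : Finset V, Z = univ.filter (fun w => ¬ D.Adj v w ∧ ¬ D.Adj u w) := ⟨_, rfl⟩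
  have memX : ∀ w, w ∈ X ↔ D.Adj v w := fun w => by rw [hX, mem_filter]; simp only [mem_univ, true_and]
  have memY : ∀ w, w ∈ Y ↔ D.Adj u w := fun w => by rw [hY, mem_filter]; simp only [mem_univ, true_and]
  have memZ : ∀ w, w ∈ Z ↔ ¬ D.Adj v w ∧ ¬ D.Adj u w := fun w => by
    rw [hZ, mem_filter]; simp only [mem_univ, true_and]
  have hXY : ∀ w, D.Adj v w → ¬ D.Adj u w := fun w hv hu => htri u v w huv hu hv
  have hXind : ∀ a b, D.Adj v a → D.Adj v b → ¬ D.Adj a b := fun a b ha hb hab => htri v a b ha hb hab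
  have hYind : ∀ a b, D.Adj u a → D.Adj u b → ¬ D.Adj a b := fun a b ha hb hab => htri u a b ha hb hab
  have huX : u ∈ X := (memX u).mpr huv.symm
  have hvY : v ∈ Y := (memY v).mpr huv
  have hYcard : Y.card = deg D u := by rw [hY]; rfl
  have hcard : X.card + Y.card + Z.card = Fintype.card V := by
    rw [hX, hY, hZ]
    have h1 := card_filter_add_card_filter_not (s := (univ : Finset V)) (fun w => D.Adj v w)
    have h2 := card_filter_add_card_filter_not (s := univ.filter (fun w => ¬ D.Adj v w))
      (fun w => D.Adj u w)
    rw [filter_filter, filter_filter] at h2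
    have e1 : (univ.filter (fun w => ¬ D.Adj v w ∧ D.Adj u w)) = univ.filter (fun w => D.Adj u w) := by
      ext w
      simp only [mem_filter, mem_univ, true_and]
      exact ⟨fun h => h.2, fun h => ⟨fun hv => hXY w hv h, h⟩⟩
    rw [e1] at h2
    rw [card_univ] at h1
    omega
  have hY4 : 4 ≤ Y.card := by rw [hYcard]; exact hu4
  have hX1 : 1 ≤ X.card := card_pos.mpr ⟨u, huX⟩
  obtain ⟨A₁, hA₁⟩ : ∃ A₁ : Finset (V × V),
      A₁ = (adjPairsAll D).filter (fun p => D.Adj v p.1 ∧ D.Adj u p.2) := ⟨_, rfl⟩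
  obtain ⟨A₃, hA₃⟩ : ∃ A₃ : Finset (V × V), A₃ = (adjPairsAll D).filter
      (fun p => (¬ D.Adj v p.1 ∧ ¬ D.Adj u p.1) ∧ (D.Adj v p.2 ∨ D.Adj u p.2)) := ⟨_, rfl⟩
  obtain ⟨A₅, hA₅⟩ : ∃ A₅ : Finset (V × V), A₅ = (adjPairsAll D).filter
      (fun p => (¬ D.Adj v p.1 ∧ ¬ D.Adj u p.1) ∧ (¬ D.Adj v p.2 ∧ ¬ D.Adj u p.2)) := ⟨_, rfl⟩
  have memA₁ : ∀ p, p ∈ A₁ ↔ D.Adj p.1 p.2 ∧ D.Adj v p.1 ∧ D.Adj u p.2 := fun p => by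
    rw [hA₁, mem_filter, mem_adjPairsAll]
  have memA₃ : ∀ p, p ∈ A₃ ↔ D.Adj p.1 p.2 ∧ (¬ D.Adj v p.1 ∧ ¬ D.Adj u p.1) ∧
      (D.Adj v p.2 ∨ D.Adj u p.2) := fun p => by
    rw [hA₃, mem_filter, mem_adjPairsAll]
  have memA₅ : ∀ p, p ∈ A₅ ↔ D.Adj p.1 p.2 ∧ (¬ D.Adj v p.1 ∧ ¬ D.Adj u p.1) ∧
      (¬ D.Adj v p.2 ∧ ¬ D.Adj u p.2) := fun p => by
    rw [hA₅, mem_filter, mem_adjPairsAll]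
  have hsplit : 2 * ∑ p ∈ A₁, deficit D p + 2 * ∑ p ∈ A₃, deficit D p + ∑ p ∈ A₅, deficit D p ≤
      ∑ p ∈ adjPairsAll D, deficit D p := by
    rw [hA₁, hA₃, hA₅]
    exact sum_deficit_split_five D htri huv
  -- the pointwise bound on `X × Y`
  have hA1 : ∀ p ∈ A₁,
      (X.filter (fun w => ¬ D.Adj p.2 w)).card + (Y.filter (fun w => ¬ D.Adj p.1 w)).card +
        (Z.filter (fun w => ¬ D.Adj p.1 w ∧ ¬ D.Adj p.2 w)).card ≤ deficit D p := by
    intro p hp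
    obtain ⟨_, hx, hy⟩ := (memA₁ p).mp hp
    unfold deficit
    have hsub : X.filter (fun w => ¬ D.Adj p.2 w) ∪ Y.filter (fun w => ¬ D.Adj p.1 w) ∪
        Z.filter (fun w => ¬ D.Adj p.1 w ∧ ¬ D.Adj p.2 w) ⊆
          univ.filter (fun x => ¬ D.Adj p.1 x ∧ ¬ D.Adj p.2 x) := by
      intro w hw
      rw [mem_filter]
      refine ⟨mem_univ _, ?_⟩
      simp only [mem_union, mem_filter] at hw
      rcases hw with (⟨hw1, hw2⟩ | ⟨hw1, hw2⟩) | ⟨_, hw2⟩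
      · exact ⟨hXind p.1 w hx ((memX w).mp hw1), hw2⟩
      · exact ⟨hw2, hYind p.2 w hy ((memY w).mp hw1)⟩
      · exact hw2
    have hd1 : Disjoint (X.filter (fun w => ¬ D.Adj p.2 w)) (Y.filter (fun w => ¬ D.Adj p.1 w)) := by
      rw [disjoint_left]
      intro w hw1 hw2
      rw [mem_filter] at hw1 hw2
      exact hXY w ((memX w).mp hw1.1) ((memY w).mp hw2.1)
    have hd2 : Disjoint (X.filter (fun w => ¬ D.Adj p.2 w) ∪ Y.filter (fun w => ¬ D.Adj p.1 w))
        (Z.filter (fun w => ¬ D.Adj p.1 w ∧ ¬ D.Adj p.2 w)) := by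
      rw [disjoint_left]
      intro w hw1 hw2
      rw [mem_filter] at hw2
      have hw2' := (memZ w).mp hw2.1
      simp only [mem_union, mem_filter] at hw1
      rcases hw1 with ⟨h, _⟩ | ⟨h, _⟩
      · exact hw2'.1 ((memX w).mp h)
      · exact hw2'.2 ((memY w).mp h)
    have := card_le_card hsub
    rw [card_union_of_disjoint hd2, card_union_of_disjoint hd1] at this
    exact this
  have hA1sum : ∑ p ∈ A₁, (X.filter (fun w => ¬ D.Adj p.2 w)).card +
      ∑ p ∈ A₁, (Y.filter (fun w => ¬ D.Adj p.1 w)).card +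
        ∑ p ∈ A₁, (Z.filter (fun w => ¬ D.Adj p.1 w ∧ ¬ D.Adj p.2 w)).card ≤
          ∑ p ∈ A₁, deficit D p := by
    rw [← sum_add_distrib, ← sum_add_distrib]
    exact sum_le_sum hA1
  suffices hkey : 6 * (X.card + Y.card + Z.card - 4) ≤
      2 * ∑ p ∈ A₁, deficit D p + 2 * ∑ p ∈ A₃, deficit D p + ∑ p ∈ A₅, deficit D p by
    rw [hcard] at hkey
    omega
  by_cases hZ0 : Z.card = 0
  · exfalso
    apply hnb
    have hZe : ∀ w, D.Adj v w ∨ D.Adj u w := by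
      intro w
      by_contra hw
      have : w ∈ Z := (memZ w).mpr (not_or.mp hw)
      rw [card_eq_zero] at hZ0
      rw [hZ0] at this
      exact notMem_empty w this
    exact bipartite_of_Z_empty D htri (u := u) X memX hZe
  by_cases hZ1 : Z.card = 1
  · exact core_Z1 D htri huv X Y Z memX memY memZ A₁ A₃ A₅ memA₁ memA₃ hA1sum hnb hY4 hZ1
  by_cases hZ2 : Z.card = 2
  · exact core_Z2 D htri huv X Y Z memX memY memZ A₁ A₃ A₅ memA₁ memA₃ memA₅ hA1sum hnb hY4 hZ2
  · -- `|Z| ≥ 3`, and `|X| + |Y| ≥ 5`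
    have hfarZ : ∑ p ∈ A₁, (Z.filter (fun w => ¬ D.Adj p.1 w ∧ ¬ D.Adj p.2 w)).card =
        ∑ z ∈ Z, (A₁.filter (fun p => ¬ D.Adj p.1 z ∧ ¬ D.Adj p.2 z)).card := by
      simp only [card_filter]
      rw [sum_comm]
    have hA3sum := edges_at_Z_lower D htri huv X Y Z memX memY memZ A₃ memA₃
    have hfarsum : ∑ z ∈ Z, ((X.filter (fun x => ¬ D.Adj z x)).card + (Y.filter (fun y => ¬ D.Adj z y)).card) ≤
        ∑ p ∈ A₁, (Z.filter (fun w => ¬ D.Adj p.1 w ∧ ¬ D.Adj p.2 w)).card + Z.card := by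
      rw [hfarZ, card_eq_sum_ones, ← sum_add_distrib]
      apply sum_le_sum
      intro z hz
      have hz' := (memZ z).mp hz
      exact far_pairs_lower D huv X Y memX memY A₁ memA₁ hz'.1 hz'.2
    have hZtotal : Z.card * (X.card + Y.card) ≤
        ∑ p ∈ A₁, (Z.filter (fun w => ¬ D.Adj p.1 w ∧ ¬ D.Adj p.2 w)).card + ∑ p ∈ A₃, deficit D p + Z.card := by
      have hper : ∀ z ∈ Z, X.card + Y.card ≤
          ((X.filter (fun w => D.Adj z w)).card * (X.filter (fun x => ¬ D.Adj z x)).card +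
            (Y.filter (fun w => D.Adj z w)).card * (Y.filter (fun y => ¬ D.Adj z y)).card) +
          ((X.filter (fun x => ¬ D.Adj z x)).card + (Y.filter (fun y => ¬ D.Adj z y)).card) := by
        intro z hz
        have hz' := (memZ z).mp hz
        exact per_z_arith D X Y huX hvY hz'.1 hz'.2
      have h := sum_le_sum hper
      rw [sum_const, smul_eq_mul, sum_add_distrib] at h
      omega
    have hZ3 : 3 ≤ Z.card := by omega
    obtain ⟨z', hz'⟩ : ∃ z', Z.card = z' + 3 := ⟨Z.card - 3, by omega⟩
    obtain ⟨s', hs'⟩ : ∃ s', X.card + Y.card = s' + 5 := ⟨X.card + Y.card - 5, by omega⟩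
    rw [hz', hs'] at hZtotal
    rw [hs', hz']
    have e : s' + 5 + (z' + 3) - 4 = s' + z' + 4 := by omega
    rw [e]
    have hexp : (z' + 3) * (s' + 5) = z' * s' + 5 * z' + 3 * s' + 15 := by ring
    rw [hexp] at hZtotal
    omega

end C047

end TriangleCap

end PercRepro
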